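import Literature.AlgebraicGeometry.GroupSchemes.StrictBirationalGroupLaw
import Mathlib.AlgebraicGeometry.Geometrically.Irreducible
import Mathlib.AlgebraicGeometry.PullbackCarrier
import HarnessLib

/-!
# «`(a₀, x) ∈ dom` and `(b₀, a₀·x) ∈ dom` for a generic `x`»: the LEFT-translated law is defined generically over
# every point (Artin, *Néron models*, §2, proofs of Lemmas 2.3–2.4) — the factor-swapped twin of
# `BirationalGroupLawGenericTranslate`

Topic `Literature/AlgebraicGeometry/GroupSchemes`, namespace `Literature.AlgebraicGeometry.GroupSchemes`.
THEOREMS ONLY (no definition, no named fact, no instance, no `sorry`).  Cell `hodgecm-mathlib` (D-0151), road W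
(Néron capital), piece (G2c-pt)/(C2) «choice of the auxiliary section `y`» of Artin's measure step (A-p06's W1c table;
B-p15's cut 15:08Z): at the point `p₀ = (a₀, b₀) = (s′(t), j x)` of `V ×_S V` one needs a section `y` with
`(s′(t), y(t)) ∈ dom′` and `(j x, s′(t)·y(t)) ∈ dom′`; by `GroupSchemes.exists_open_forall_section_lift_mem`
(`SectionsThroughFibreDenseOpens.lean`) such sections exist through some open meeting the fibre `V_t` as soon as

  `O₂′ = {(v, (a, b)) : (a, v) ∈ dom ∧ (b, a·v) ∈ dom} ⊆ V ×_S (V ×_S V)`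

is DENSE IN THE FIBRE of `pr₂ : V ×_S (V ×_S V) ⟶ V ×_S V` over `p₀`.  This file proves that density
(`BirationalGroupLaw.fibre_subset_closure_leftTranslateDom`) for a STRICT law on `𝒳 → S` universally open with
geometrically irreducible fibres — A-p13's `fibre_subset_closure_translateDom` (★ `BirationalGroupLawGenericTranslate`)
with the two factors exchanged: `α′ = (v, (a, b)) ↦ (a, v)` is a base change onto the `pr₁`-fibre over `a`, whose generic
point lies in `dom` (strictness, first-projection density); `Θ′ = (v, a, b) ↦ (b, a·v)` is the base change `Φ × id` of
the LEFT shear `Φ : (a, v) ↦ (a, a·v)` (an open immersion) followed by `β′ = (u, (a, b)) ↦ (b, u)` (a base change onto the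
`pr₁`-fibre over `b`), so `Θ′(ζ)` is generic in `pr₁⁻¹(b)`, again in `dom` by strictness.  Banked leaf; no floor change.

## References
* [Artin1986NeronModels] M. Artin, *Néron models*, in Cornell–Silverman (eds.), *Arithmetic Geometry*, Springer
  1986, §2, Lemmas 2.3–2.4 and their proofs (p. 222), and (2.2) (p. 221).
* [EdixhovenRomagny] B. Edixhoven, M. Romagny, *Group schemes out of birational group laws, Néron models*, Panor.
  Synthèses 47 (2015), Def. 3.4 (2) (strictness on `T`-points).
-/

set_option autoImplicit false

noncomputable section

namespace Literature.AlgebraicGeometry.GroupSchemes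

open CategoryTheory CategoryTheory.Limits _root_.AlgebraicGeometry MonoidalCategory CartesianMonoidalCategory
open TopologicalSpace Topology
open scoped CategoryTheory.Obj

universe u

variable {S : Scheme.{u}} {𝒳 : Over S}

/-! ## §1. Generic points of fibres -/

/-- A point `ζ` of an irreducible fibre `h⁻¹(y)` which is generic in it: `ζ ∈ h⁻¹(y)` and
`h⁻¹(y) ⊆ closure {ζ}` (the generic point of the closure of the fibre lies in the fibre, schemes being `T₀`).
[folklore] -/
private theorem exists_generic_of_isIrreducible_fibre {W P : Scheme.{u}} (h : W ⟶ P) (y : P)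
    (hirr : IsIrreducible (h ⁻¹' {y})) : ∃ ζ : W, h ζ = y ∧ h ⁻¹' {y} ⊆ closure {ζ} := by
  set Z : Set W := h ⁻¹' {y} with hZ
  have hgen : IsGenericPoint hirr.genericPoint (closure Z) := hirr.isGenericPoint_genericPoint_closure
  set ζ := hirr.genericPoint with hζ
  have hZsub : Z ⊆ closure {ζ} := by rw [hgen]; exact subset_closure
  refine ⟨ζ, ?_, hZsub⟩
  -- `h ζ` specialises to `y` and `y` specialises to `h ζ`
  have hζcl : ζ ∈ closure Z := by rw [← hgen]; exact subset_closure (Set.mem_singleton ζ)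
  have h1 : h ζ ∈ closure {y} := by
    have : h '' closure Z ⊆ closure (h '' Z) := image_closure_subset_closure_image h.continuous
    have hy : h '' Z ⊆ {y} := by rintro _ ⟨w, hw, rfl⟩; exact hw
    exact closure_mono hy (this ⟨ζ, hζcl, rfl⟩)
  obtain ⟨z, hz⟩ := hirr.nonempty
  have h2 : y ∈ closure {h ζ} := by
    have hz' : z ∈ closure {ζ} := hZsub hz
    have : h z ∈ closure {h ζ} := by
      have := image_closure_subset_closure_image h.continuous ⟨z, hz', rfl⟩
      rwa [Set.image_singleton] at this
    rw [show h z = y from hz] at this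
    exact this
  have hs1 : h ζ ⤳ y := specializes_iff_mem_closure.mpr h2
  have hs2 : y ⤳ h ζ := specializes_iff_mem_closure.mpr h1
  exact (hs1.antisymm hs2).eq

/-- A point generic in a set lies in every open set meeting it. [folklore] -/
private theorem mem_of_isOpen_of_inter_nonempty {W : Scheme.{u}} {Z : Set W} {ζ : W} (hZ : Z ⊆ closure {ζ})
    {O : Set W} (hO : IsOpen O) (hne : (O ∩ Z).Nonempty) : ζ ∈ O := by
  obtain ⟨w, hwO, hwZ⟩ := hne
  have hw : w ∈ closure ({ζ} : Set W) := hZ hwZ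
  rw [mem_closure_iff] at hw
  obtain ⟨_, h1, rfl⟩ := hw O hO hwO
  exact h1

/-- If a morphism maps a set `Z`, generic point `ζ`, ONTO a set `Z'`, then `Z' ⊆ closure {f ζ}`. [folklore] -/
private theorem subset_closure_image_of_surjOn {W P : Scheme.{u}} (f : W ⟶ P) {Z : Set W} {ζ : W}
    (hZ : Z ⊆ closure {ζ}) {Z' : Set P} (hsurj : Z' ⊆ f '' Z) : Z' ⊆ closure {f ζ} := by
  intro z' hz'
  obtain ⟨z, hz, rfl⟩ := hsurj hz'
  have := image_closure_subset_closure_image f.continuous ⟨z, hZ hz, rfl⟩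
  rwa [Set.image_singleton] at this

/-! ## §2. The maps `α′ = (v,(a,b)) ↦ (a,v)` and `β′ = (u,(a,b)) ↦ (b,u)` are base changes -/

section AlphaBeta

variable (𝒳)

/-- A morphism `α′ : V ×_S (V ×_S V) ⟶ V ×_S V` with coordinates `(v, (a, b)) ↦ (a, v)` is a base change: the square
with the second projection and the FIRST projections over `V` is cartesian. [folklore] -/
private theorem isPullback_of_coord_fst' (α : pullback 𝒳.hom (𝒳 ⊗ 𝒳).hom ⟶ (𝒳 ⊗ 𝒳).left)
    (h1 : α ≫ (fst 𝒳 𝒳).left = pullback.snd 𝒳.hom (𝒳 ⊗ 𝒳).hom ≫ (fst 𝒳 𝒳).left)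
    (h2 : α ≫ (snd 𝒳 𝒳).left = pullback.fst 𝒳.hom (𝒳 ⊗ 𝒳).hom) :
    IsPullback α (pullback.snd 𝒳.hom (𝒳 ⊗ 𝒳).hom) (fst 𝒳 𝒳).left (fst 𝒳 𝒳).left := by
  have hw : (𝒳 ⊗ 𝒳).hom = (fst 𝒳 𝒳).left ≫ 𝒳.hom := (Over.w (fst 𝒳 𝒳)).symm
  have big : IsPullback (α ≫ (snd 𝒳 𝒳).left) (pullback.snd 𝒳.hom (𝒳 ⊗ 𝒳).hom) 𝒳.hom
      ((fst 𝒳 𝒳).left ≫ 𝒳.hom) := by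
    rw [h2, ← hw]
    exact IsPullback.of_hasPullback 𝒳.hom (𝒳 ⊗ 𝒳).hom
  exact IsPullback.of_right big h1 (IsPullback.of_hasPullback 𝒳.hom 𝒳.hom).flip

/-- A morphism `β′ : V ×_S (V ×_S V) ⟶ V ×_S V` with coordinates `(u, (a, b)) ↦ (b, u)` is a base change: the square
with the second projection, the first projection `V ×_S V ⟶ V` and the second projection `V ×_S V ⟶ V` is cartesian.
[folklore] -/
private theorem isPullback_of_coord_snd' (β : pullback 𝒳.hom (𝒳 ⊗ 𝒳).hom ⟶ (𝒳 ⊗ 𝒳).left)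
    (h1 : β ≫ (fst 𝒳 𝒳).left = pullback.snd 𝒳.hom (𝒳 ⊗ 𝒳).hom ≫ (snd 𝒳 𝒳).left)
    (h2 : β ≫ (snd 𝒳 𝒳).left = pullback.fst 𝒳.hom (𝒳 ⊗ 𝒳).hom) :
    IsPullback β (pullback.snd 𝒳.hom (𝒳 ⊗ 𝒳).hom) (fst 𝒳 𝒳).left (snd 𝒳 𝒳).left := by
  have hw : (𝒳 ⊗ 𝒳).hom = (snd 𝒳 𝒳).left ≫ 𝒳.hom := (Over.w (snd 𝒳 𝒳)).symm
  have big : IsPullback (β ≫ (snd 𝒳 𝒳).left) (pullback.snd 𝒳.hom (𝒳 ⊗ 𝒳).hom) 𝒳.hom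
      ((snd 𝒳 𝒳).left ≫ 𝒳.hom) := by
    rw [h2, ← hw]
    exact IsPullback.of_hasPullback 𝒳.hom (𝒳 ⊗ 𝒳).hom
  exact IsPullback.of_right big h1 (IsPullback.of_hasPullback 𝒳.hom 𝒳.hom).flip

end AlphaBeta

/-! ## §3. The left-translated law is defined generically over every point -/

namespace BirationalGroupLaw

variable (L : BirationalGroupLaw 𝒳)

/-- **Density of «`av` and `b(av)`… precisely `(a, v) ∈ dom` and `(b, a·v) ∈ dom` — in the fibre over a point
`(a, b)`** ([Artin1986NeronModels] §2, proofs of Lemmas 2.3–2.4, for scheme points; the factor-swapped twin of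
`fibre_subset_closure_translateDom`).  Let `L` be a STRICT birational group law on `𝒳 → S` universally open with
geometrically irreducible fibres.  Let `W = V ×_S (V ×_S V)` (Mathlib `pullback 𝒳.hom (𝒳 ⊗ 𝒳).hom`),
`α′ : W → V ×_S V` the morphism with coordinates `(v,(a,b)) ↦ (a,v)`, `A′ = α′⁻¹ dom`, and `Θ′ : A′ → V ×_S V` the
morphism with coordinates `(v,a,b) ↦ (b, a·v)` (both characterised by their coordinates).  Then for every point `p₀`
of `V ×_S V` the open `{w ∈ A′ : Θ′ w ∈ dom}` is dense in the fibre of `pr₂ : W → V ×_S V` over `p₀` — the shape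
consumed by `GroupSchemes.exists_open_forall_section_lift_mem` («for a section `y` generic in the fibre of `t`:
`(s′ t, y t) ∈ dom` and `(j x, s′ t · y t) ∈ dom`»).
[cite: Artin1986NeronModels, §2, proofs of Lemmas 2.3–2.4 (p. 222) and (2.2) (p. 221)] [cite: EdixhovenRomagny, Def. 3.4 (2)] -/
theorem fibre_subset_closure_leftTranslateDom [UniversallyOpen 𝒳.hom] [GeometricallyIrreducible 𝒳.hom]
    (hL : L.IsStrict) (α : pullback 𝒳.hom (𝒳 ⊗ 𝒳).hom ⟶ (𝒳 ⊗ 𝒳).left)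
    (hα₁ : α ≫ (fst 𝒳 𝒳).left = pullback.snd 𝒳.hom (𝒳 ⊗ 𝒳).hom ≫ (fst 𝒳 𝒳).left)
    (hα₂ : α ≫ (snd 𝒳 𝒳).left = pullback.fst 𝒳.hom (𝒳 ⊗ 𝒳).hom)
    (Θ : ((α ⁻¹ᵁ L.dom : (pullback 𝒳.hom (𝒳 ⊗ 𝒳).hom).Opens) : Scheme.{u}) ⟶ (𝒳 ⊗ 𝒳).left)
    (hΘ₁ : Θ ≫ (fst 𝒳 𝒳).left = (α ⁻¹ᵁ L.dom).ι ≫ pullback.snd 𝒳.hom (𝒳 ⊗ 𝒳).hom ≫ (snd 𝒳 𝒳).left)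
    (hΘ₂ : Θ ≫ (snd 𝒳 𝒳).left = (α ∣_ L.dom) ≫ L.mul)
    (p₀ : ↑(𝒳 ⊗ 𝒳).left) :
    (pullback.snd 𝒳.hom (𝒳 ⊗ 𝒳).hom) ⁻¹' {p₀} ⊆
      closure ((((α ⁻¹ᵁ L.dom).ι ''ᵁ (Θ ⁻¹ᵁ L.dom) : (pullback 𝒳.hom (𝒳 ⊗ 𝒳).hom).Opens) :
          Set ↑(pullback 𝒳.hom (𝒳 ⊗ 𝒳).hom)) ∩ (pullback.snd 𝒳.hom (𝒳 ⊗ 𝒳).hom) ⁻¹' {p₀}) := by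
  -- notation: the left shear `Φ'`, retyped on `↑dom`
  let Φ' : (L.dom : Scheme.{u}) ⟶ (𝒳 ⊗ 𝒳).left := L.shearLeft.left
  haveI hΦo : IsOpenImmersion Φ' := L.isOpenImmersion_shearLeft
  have hΦ1 : Φ' ≫ (fst 𝒳 𝒳).left = L.dom.ι ≫ (fst 𝒳 𝒳).left :=
    congrArg CommaMorphism.left (LawData.shearLeft_fst 𝒳 L.dom L.mul L.mul_comp)
  have hΦ2 : Φ' ≫ (snd 𝒳 𝒳).left = L.mul :=
    congrArg CommaMorphism.left (LawData.shearLeft_snd 𝒳 L.dom L.mul L.mul_comp)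
  have hres : (α ∣_ L.dom) ≫ L.dom.ι = (α ⁻¹ᵁ L.dom).ι ≫ α := morphismRestrict_ι _ _
  intro w hw
  -- the fibre `F` over `p₀` is irreducible; take a point `ζ` generic in it
  have hirrF : IsIrreducible ((pullback.snd 𝒳.hom (𝒳 ⊗ 𝒳).hom) ⁻¹' {p₀}) :=
    (pullback.snd 𝒳.hom (𝒳 ⊗ 𝒳).hom).isIrreducible_preimage (pullback.snd 𝒳.hom (𝒳 ⊗ 𝒳).hom).isOpenMap isIrreducible_singleton
  obtain ⟨ζ, hζy, hζgen⟩ := exists_generic_of_isIrreducible_fibre (pullback.snd 𝒳.hom (𝒳 ⊗ 𝒳).hom) p₀ hirrF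
  -- it suffices to show `ζ ∈ O₂′`
  suffices hζO : ζ ∈ (((α ⁻¹ᵁ L.dom).ι ''ᵁ (Θ ⁻¹ᵁ L.dom) : (pullback 𝒳.hom (𝒳 ⊗ 𝒳).hom).Opens) :
      Set ↑(pullback 𝒳.hom (𝒳 ⊗ 𝒳).hom)) by
    have hmem : ζ ∈ (((α ⁻¹ᵁ L.dom).ι ''ᵁ (Θ ⁻¹ᵁ L.dom) : (pullback 𝒳.hom (𝒳 ⊗ 𝒳).hom).Opens) :
        Set ↑(pullback 𝒳.hom (𝒳 ⊗ 𝒳).hom)) ∩ (pullback.snd 𝒳.hom (𝒳 ⊗ 𝒳).hom) ⁻¹' {p₀} := ⟨hζO, hζy⟩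
    exact closure_mono (Set.singleton_subset_iff.mpr hmem) (hζgen hw)
  -- (1) `α ζ` is generic in the `fst`-fibre of `V ×_S V` over `a₀ = fst p₀`, hence lies in `dom`
  have hαpb := isPullback_of_coord_fst' 𝒳 α hα₁ hα₂
  have hαζ_fst : (fst 𝒳 𝒳).left (α ζ) = (fst 𝒳 𝒳).left p₀ := by
    change (α ≫ (fst 𝒳 𝒳).left) ζ = _
    rw [hα₁]
    change (fst 𝒳 𝒳).left ((pullback.snd 𝒳.hom (𝒳 ⊗ 𝒳).hom) ζ) = _
    rw [hζy]
  have hGa : (fst 𝒳 𝒳).left ⁻¹' {(fst 𝒳 𝒳).left p₀} ⊆ closure {α ζ} := by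
    refine subset_closure_image_of_surjOn α hζgen fun d hd => ?_
    obtain ⟨w', hw'1, hw'2⟩ := Scheme.exists_preimage_of_isPullback hαpb d p₀ hd
    exact ⟨w', hw'2, hw'1⟩
  have hαζ : α ζ ∈ L.dom := by
    obtain ⟨⟨hdfst, -⟩, -, -⟩ := hL
    exact mem_of_isOpen_of_inter_nonempty hGa L.dom.2 (hdfst.nonempty_inter_fibre ⟨α ζ, hαζ_fst⟩)
  have hζA : ζ ∈ α ⁻¹ᵁ L.dom := hαζ
  obtain ⟨ζA, hζA'⟩ : ζ ∈ Set.range (α ⁻¹ᵁ L.dom).ι := by rw [Scheme.Opens.range_ι]; exact hζA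
  -- (2) `Θ ζA` is generic in the `fst`-fibre over `b₀ = snd p₀`: write `Θ = Φ₃ ≫ β'`
  -- the morphism `Φ₃ : A′ ⟶ W`, `(v, a, b) ↦ (a·v, (a, b))`
  have hαS : α ≫ (𝒳 ⊗ 𝒳).hom = pullback.snd 𝒳.hom (𝒳 ⊗ 𝒳).hom ≫ (𝒳 ⊗ 𝒳).hom :=
    calc α ≫ (𝒳 ⊗ 𝒳).hom = α ≫ (fst 𝒳 𝒳).left ≫ 𝒳.hom := by rw [Over.w (fst 𝒳 𝒳)]
      _ = pullback.snd 𝒳.hom (𝒳 ⊗ 𝒳).hom ≫ (fst 𝒳 𝒳).left ≫ 𝒳.hom := by rw [reassoc_of% hα₁]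
      _ = pullback.snd 𝒳.hom (𝒳 ⊗ 𝒳).hom ≫ (𝒳 ⊗ 𝒳).hom := by rw [Over.w (fst 𝒳 𝒳)]
  have hw3 : ((α ∣_ L.dom) ≫ L.mul) ≫ 𝒳.hom = ((α ⁻¹ᵁ L.dom).ι ≫ (pullback.snd 𝒳.hom (𝒳 ⊗ 𝒳).hom)) ≫ (𝒳 ⊗ 𝒳).hom := by
    rw [Category.assoc, L.mul_comp, ← Category.assoc, hres, Category.assoc, Category.assoc, hαS]
  let Φ₃ : ((α ⁻¹ᵁ L.dom : (pullback 𝒳.hom (𝒳 ⊗ 𝒳).hom).Opens) : Scheme.{u}) ⟶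
      pullback 𝒳.hom (𝒳 ⊗ 𝒳).hom :=
    pullback.lift ((α ∣_ L.dom) ≫ L.mul) ((α ⁻¹ᵁ L.dom).ι ≫ (pullback.snd 𝒳.hom (𝒳 ⊗ 𝒳).hom)) hw3
  have hΦ₃1 : Φ₃ ≫ pullback.fst 𝒳.hom (𝒳 ⊗ 𝒳).hom = (α ∣_ L.dom) ≫ L.mul := pullback.lift_fst _ _ _
  have hΦ₃2 : Φ₃ ≫ (pullback.snd 𝒳.hom (𝒳 ⊗ 𝒳).hom) = (α ⁻¹ᵁ L.dom).ι ≫ (pullback.snd 𝒳.hom (𝒳 ⊗ 𝒳).hom) := pullback.lift_snd _ _ _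
  -- the square `A′ —Φ₃→ W —α→ V ×_S V ← Φ — dom ← α| — A′` is cartesian, so `Φ₃` is an open immersion
  have hsq : Φ₃ ≫ α = (α ∣_ L.dom) ≫ Φ' := by
    apply pullback.hom_ext
    · change (Φ₃ ≫ α) ≫ (fst 𝒳 𝒳).left = ((α ∣_ L.dom) ≫ Φ') ≫ (fst 𝒳 𝒳).left
      rw [Category.assoc, hα₁, reassoc_of% hΦ₃2, Category.assoc, hΦ1, reassoc_of% hres, hα₁]
    · change (Φ₃ ≫ α) ≫ (snd 𝒳 𝒳).left = ((α ∣_ L.dom) ≫ Φ') ≫ (snd 𝒳 𝒳).left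
      rw [Category.assoc, hα₂, hΦ₃1, Category.assoc, hΦ2]
  -- cone data
  have hcone : ∀ t : PullbackCone α Φ',
      (t.snd ≫ L.dom.ι ≫ (snd 𝒳 𝒳).left) ≫ 𝒳.hom = (t.fst ≫ (pullback.snd 𝒳.hom (𝒳 ⊗ 𝒳).hom)) ≫ (𝒳 ⊗ 𝒳).hom := fun t => by
    have h := congrArg (· ≫ (snd 𝒳 𝒳).left ≫ 𝒳.hom) t.condition
    simp only [Category.assoc, reassoc_of% hΦ2] at h
    rw [reassoc_of% hα₂, pullback.condition] at h
    rw [Category.assoc, Category.assoc, Over.w (snd 𝒳 𝒳), ← L.mul_comp, Category.assoc]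
    exact h.symm
  have hconeα : ∀ t : PullbackCone α Φ',
      pullback.lift (t.snd ≫ L.dom.ι ≫ (snd 𝒳 𝒳).left) (t.fst ≫ (pullback.snd 𝒳.hom (𝒳 ⊗ 𝒳).hom)) (hcone t) ≫ α = t.snd ≫ L.dom.ι :=
    fun t => by
    have h1 := congrArg (· ≫ (fst 𝒳 𝒳).left) t.condition
    simp only [Category.assoc, hα₁, hΦ1] at h1
    apply pullback.hom_ext
    · have e3 : pullback.lift (t.snd ≫ L.dom.ι ≫ (snd 𝒳 𝒳).left) (t.fst ≫ (pullback.snd 𝒳.hom (𝒳 ⊗ 𝒳).hom))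
          (hcone t) ≫ (pullback.snd 𝒳.hom (𝒳 ⊗ 𝒳).hom) = t.fst ≫ (pullback.snd 𝒳.hom (𝒳 ⊗ 𝒳).hom) :=
        pullback.lift_snd _ _ _
      change (_ ≫ α) ≫ (fst 𝒳 𝒳).left = (t.snd ≫ L.dom.ι) ≫ (fst 𝒳 𝒳).left
      rw [Category.assoc, hα₁, reassoc_of% e3, Category.assoc]
      exact h1
    · change (_ ≫ α) ≫ (snd 𝒳 𝒳).left = (t.snd ≫ L.dom.ι) ≫ (snd 𝒳 𝒳).left
      rw [Category.assoc, hα₂, pullback.lift_fst, Category.assoc]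
  have hconeRange : ∀ t : PullbackCone α Φ',
      Set.range (pullback.lift (t.snd ≫ L.dom.ι ≫ (snd 𝒳 𝒳).left) (t.fst ≫ (pullback.snd 𝒳.hom (𝒳 ⊗ 𝒳).hom)) (hcone t)) ⊆
        Set.range (α ⁻¹ᵁ L.dom).ι := fun t => by
    rintro _ ⟨x, rfl⟩
    rw [Scheme.Opens.range_ι]
    change (pullback.lift (t.snd ≫ L.dom.ι ≫ (snd 𝒳 𝒳).left) (t.fst ≫ (pullback.snd 𝒳.hom (𝒳 ⊗ 𝒳).hom)) (hcone t) ≫ α) x ∈ L.dom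
    rw [hconeα]
    change L.dom.ι (t.snd x) ∈ L.dom
    rw [← SetLike.mem_coe, ← Scheme.Opens.range_ι]
    exact ⟨_, rfl⟩
  have hpb : IsPullback Φ₃ (α ∣_ L.dom) α Φ' := by
    refine IsPullback.of_isLimit' ⟨hsq⟩ (PullbackCone.IsLimit.mk hsq
      (fun t => IsOpenImmersion.lift (α ⁻¹ᵁ L.dom).ι _ (hconeRange t))
      (fun t => ?_) (fun t => ?_) (fun t m hm₁ hm₂ => ?_))
    · -- `lift ≫ Φ₃ = t.fst`
      have e1 : IsOpenImmersion.lift (α ⁻¹ᵁ L.dom).ι _ (hconeRange t) ≫ (α ∣_ L.dom) = t.snd := by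
        rw [← cancel_mono L.dom.ι, Category.assoc, hres, ← Category.assoc, IsOpenImmersion.lift_fac]
        exact hconeα t
      have h := congrArg (· ≫ (snd 𝒳 𝒳).left) t.condition
      simp only [Category.assoc, hα₂, hΦ2] at h
      apply pullback.hom_ext
      · rw [Category.assoc, hΦ₃1, ← Category.assoc, e1]
        exact h.symm
      · rw [Category.assoc, hΦ₃2, ← Category.assoc, IsOpenImmersion.lift_fac, pullback.lift_snd]
    · -- `lift ≫ α| = t.snd`
      rw [← cancel_mono L.dom.ι, Category.assoc, hres, ← Category.assoc, IsOpenImmersion.lift_fac]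
      exact hconeα t
    · -- uniqueness
      rw [← cancel_mono (α ⁻¹ᵁ L.dom).ι, IsOpenImmersion.lift_fac]
      apply pullback.hom_ext
      · rw [pullback.lift_fst, Category.assoc, ← hα₂, ← Category.assoc (α ⁻¹ᵁ L.dom).ι, ← hres,
          Category.assoc, reassoc_of% hm₂]
      · rw [pullback.lift_snd, Category.assoc, ← hΦ₃2, ← Category.assoc, hm₁]
  have hΦ₃o : IsOpenImmersion Φ₃ :=
    MorphismProperty.IsStableUnderBaseChange.of_isPullback (P := @IsOpenImmersion) hpb.flip hΦo
  -- `F ⊆ closure {Φ₃ ζA}`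
  have hζAF : (pullback.snd 𝒳.hom (𝒳 ⊗ 𝒳).hom) (Φ₃ ζA) = p₀ := by
    change (Φ₃ ≫ (pullback.snd 𝒳.hom (𝒳 ⊗ 𝒳).hom)) ζA = p₀
    rw [hΦ₃2]
    change (pullback.snd 𝒳.hom (𝒳 ⊗ 𝒳).hom) ((α ⁻¹ᵁ L.dom).ι ζA) = p₀
    rw [hζA', hζy]
  have hFΦ : (pullback.snd 𝒳.hom (𝒳 ⊗ 𝒳).hom) ⁻¹' {p₀} ⊆ closure {Φ₃ ζA} := by
    have hU : IsOpen (Set.range Φ₃) := Φ₃.isOpenEmbedding.isOpen_range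
    have hne : ((pullback.snd 𝒳.hom (𝒳 ⊗ 𝒳).hom) ⁻¹' {p₀} ∩ Set.range Φ₃).Nonempty := ⟨Φ₃ ζA, hζAF, ζA, rfl⟩
    refine (subset_closure_inter_of_isPreirreducible_of_isOpen hirrF.isPreirreducible hU hne).trans
      ((isClosed_closure).closure_subset_iff.mpr ?_)
    rintro _ ⟨hu, a', rfl⟩
    have ha'F : (α ⁻¹ᵁ L.dom).ι a' ∈ (pullback.snd 𝒳.hom (𝒳 ⊗ 𝒳).hom) ⁻¹' {p₀} := by
      change ((α ⁻¹ᵁ L.dom).ι ≫ (pullback.snd 𝒳.hom (𝒳 ⊗ 𝒳).hom)) a' = p₀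
      rw [← hΦ₃2]
      exact hu
    have ha'cl : a' ∈ closure ({ζA} : Set ↑(α ⁻¹ᵁ L.dom)) := by
      have h1 : (α ⁻¹ᵁ L.dom).ι a' ∈ closure {ζ} := hζgen ha'F
      rw [← hζA'] at h1
      have h2 := (α ⁻¹ᵁ L.dom).ι.isOpenEmbedding.isOpenMap.preimage_closure_eq_closure_preimage
        (α ⁻¹ᵁ L.dom).ι.continuous {(α ⁻¹ᵁ L.dom).ι ζA}
      have h3 : a' ∈ (α ⁻¹ᵁ L.dom).ι ⁻¹' closure {(α ⁻¹ᵁ L.dom).ι ζA} := h1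
      rw [h2, ← Set.image_singleton, Set.preimage_image_eq _ (α ⁻¹ᵁ L.dom).ι.isOpenEmbedding.injective] at h3
      exact h3
    have := image_closure_subset_closure_image Φ₃.continuous ⟨a', ha'cl, rfl⟩
    rwa [Set.image_singleton] at this
  -- the morphism `β' : W ⟶ V ×_S V`, `(u, (a, b)) ↦ (b, u)`, maps `F` onto the `fst`-fibre over `b₀ = snd p₀`
  have hwβ : ((pullback.snd 𝒳.hom (𝒳 ⊗ 𝒳).hom) ≫ (snd 𝒳 𝒳).left) ≫ 𝒳.hom = pullback.fst 𝒳.hom (𝒳 ⊗ 𝒳).hom ≫ 𝒳.hom := by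
    rw [Category.assoc, Over.w (snd 𝒳 𝒳), pullback.condition]
  let β' : pullback 𝒳.hom (𝒳 ⊗ 𝒳).hom ⟶ (𝒳 ⊗ 𝒳).left :=
    pullback.lift ((pullback.snd 𝒳.hom (𝒳 ⊗ 𝒳).hom) ≫ (snd 𝒳 𝒳).left) (pullback.fst 𝒳.hom (𝒳 ⊗ 𝒳).hom) hwβ
  have hβ1 : β' ≫ (fst 𝒳 𝒳).left = (pullback.snd 𝒳.hom (𝒳 ⊗ 𝒳).hom) ≫ (snd 𝒳 𝒳).left := pullback.lift_fst _ _ _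
  have hβ2 : β' ≫ (snd 𝒳 𝒳).left = pullback.fst 𝒳.hom (𝒳 ⊗ 𝒳).hom := pullback.lift_snd _ _ _
  have hβpb := isPullback_of_coord_snd' 𝒳 β' hβ1 hβ2
  have hGb : (fst 𝒳 𝒳).left ⁻¹' {(snd 𝒳 𝒳).left p₀} ⊆ closure {β' (Φ₃ ζA)} := by
    refine subset_closure_image_of_surjOn β' hFΦ fun d hd => ?_
    obtain ⟨w', hw'1, hw'2⟩ := Scheme.exists_preimage_of_isPullback hβpb d p₀ hd
    exact ⟨w', hw'2, hw'1⟩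
  -- `Θ = Φ₃ ≫ β'`
  have hΘ : Θ = Φ₃ ≫ β' := by
    apply pullback.hom_ext
    · change Θ ≫ (fst 𝒳 𝒳).left = (Φ₃ ≫ β') ≫ (fst 𝒳 𝒳).left
      rw [hΘ₁, Category.assoc, hβ1, reassoc_of% hΦ₃2]
    · change Θ ≫ (snd 𝒳 𝒳).left = (Φ₃ ≫ β') ≫ (snd 𝒳 𝒳).left
      rw [hΘ₂, Category.assoc, hβ2, hΦ₃1]
  have hΘζ_fst : (fst 𝒳 𝒳).left (Θ ζA) = (snd 𝒳 𝒳).left p₀ := by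
    change (Θ ≫ (fst 𝒳 𝒳).left) ζA = _
    rw [hΘ₁]
    change (snd 𝒳 𝒳).left ((pullback.snd 𝒳.hom (𝒳 ⊗ 𝒳).hom) ((α ⁻¹ᵁ L.dom).ι ζA)) = _
    rw [hζA', hζy]
  have hΘζ : Θ ζA ∈ L.dom := by
    obtain ⟨⟨hdfst, -⟩, -, -⟩ := hL
    have hG : (fst 𝒳 𝒳).left ⁻¹' {(snd 𝒳 𝒳).left p₀} ⊆ closure {Θ ζA} := by
      rw [hΘ]; exact hGb
    exact mem_of_isOpen_of_inter_nonempty hG L.dom.2 (hdfst.nonempty_inter_fibre ⟨Θ ζA, hΘζ_fst⟩)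
  -- conclude
  rw [← hζA']
  exact ⟨ζA, hΘζ, rfl⟩

end BirationalGroupLaw

end Literature.AlgebraicGeometry.GroupSchemes

end
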